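import Summits.BirchSwinnertonDyer.Rank1Residual.Additive.KatoDescentStrictSelmerCount
import Summits.BirchSwinnertonDyer.Rank1Residual.Additive.KatoDescentIntegralH1KummerIndex
import HarnessLib

set_option autoImplicit false

/-!
# Route `ErratumRoadFive`, crux 19715 `EulerHalfNotRamNoInertSetAtFive`, line `kato_Fframe` (r5.x), stub S1Λ
# `stub_katoLambdaLogBoundTamagawa` — HELPER L3′ (R-G): the `A`-LINE INDEX `[A₀ : ℤ_p y] = p^{v(t) − a − v(log_ω P)}`

Seat `bsd-idea-9` (planner/ideator, g40), `--supports stmt-BirchSwinnertonDyer-19715` as HELPER (LEAD `bsd-line-er5-p1` g8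
partition 2026-08-30T06:12:43Z: «L3′ (R-G) → bsd-idea-9»); W-79: no registration touched; theorems only (no `def`, no named fact,
no instance, no notation, no `sorry`).

THE STATEMENT (line memo `Lines/kato_Fframe_r5_S1Lambda_level0.md` §1 (3)).  On the rank-one rows (`W/ℚ` globally minimal,
`rank_ℤ W(ℚ) = 1` generated by `P` modulo torsion, `Ш(W/ℚ)[p^∞]` finite, `p ∤ #W(ℚ)_tors`), with `x = κ_∞(P) ∈ H¹(ℚ, T_pW)` the
`T_p`-adic Kummer class and `a` THE lattice exponent (`A = H¹(ℤ[1/p], T_pW) = integralH1 (tateRep W p) p ⊤ = ℤ_p ∙ (p^a • x)`,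
cell `bsd-cm` `GlobalKummer.exists_integralH1_eq_span_pow_smul`), for ANY `ℤ_p`-extension datum `κ` and ANY class `y` of the
bottom-layer lattice `A₀ = integralH1 (tateRep W p) p (κ.layerSubgroup 0)` whose Kummer logarithm is `t ≠ 0`
(`HasLocPKummerLog W p (layerZeroToTop y) t`):
**`a + v(log_ω P) ≤ v(t)` and `#(A₀ / ℤ_p ∙ y) = p^{v(t) − a − v(log_ω P)}`.**
In S1Λ, `y = proj₀ z₀` for Kato's admissible zeta class `z₀ ∈ 𝐇¹_Γ` and `t = t_K` is the bottom Kummer logarithm of the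
hypothesis `HasLocPKummerLog W p (bottomClass W p K I z₀) t`; the corollary `…_proj` is stated in exactly the quotient currency of
the Herbrand helper `ErratumRoadFiveKatoFframeH2CoinvariantsIndex` (`#(𝐇²_Γ)_Γ ∣ #(A₀ / ℤ_p ∙ proj₀ s)`), so that
`#(𝐇²_Γ)_Γ ∣ p^{v(t_K) − a − v(log_ω P)}` is one `rw` away.

PROOF = the tree's index calculus of cell `bsd-cm` assembled: a Kummer-log functional `φ` on `A₀`
(`LocPKummer.exists_kummerLog_linearMap`), `φ y = t` (uniqueness of the Kummer logarithm), `φ(A₀) = p^{v₀} ℤ_p`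
(`LocPKummer.exists_range_eq_span_zpow`), `v₀ = a + v(log_ω P)` (`GlobalKummer.exists_integralH1_eq_span_pow_smul_and_eq_add_valuation`
+ `StrictCount.eq_of_integralH1_eq_span_pow_smul`), the index formula `#(A₀ / ℤ_p y) = #ker φ · p^{v(φ y) − v₀}`
(`LocPKummer.natCard_quotient_span_singleton_eq`) and `#ker φ = 1` on the rows (`LocPKummer.kummerLog_injective_of_not_dvd_torsionOrder`).

HONEST LABEL: helper theorems; no stub or item is closed; nothing is registered; S1Λ is NOT proved here; Kato's Main Conjecture
is not touched; BSD is proved for no curve.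
References: [Kato2004Asterisque] Thm. 14.5 and the definition of `[M : z]` (pp. 236–237), §14.14 (14.14.1) (p. 243), §14.18
(p. 244); [BlochKato1990] Def. 3.10, Ex. 3.11; [SerreLocalFields1979] Ch. II §3.
-/

noncomputable section

open scoped Classical NumberField ContRepresentation

open WeierstrassCurve Field IsDedekindDomain NumberField CategoryTheory Literature.NumberTheory.EllipticCurves
  Literature.NumberTheory.EllipticCurves.Kato2004 Literature.NumberTheory.GaloisRepresentations
  Literature.NumberTheory.GaloisRepresentations.DiscreteGaloisModule
  Literature.NumberTheory.EllipticCurves.Kato2004.EulerSystemValues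
open WeierstrassCurve (geomPoints geomTorsion geomPrimaryTorsion galH1Primary kummerMapTorsion)
open Literature.NumberTheory.EllipticCurves.Rank1Residual
open Summit.BirchSwinnertonDyer.Rank1Residual.Additive Summit.BirchSwinnertonDyer.Rank1Residual.Additive.StrictCount
open Summit.BirchSwinnertonDyer.Rank1Residual.Additive.GlobalKummer Summit.BirchSwinnertonDyer.Rank1Residual.Additive.LocPKummer
  Summit.BirchSwinnertonDyer.BirchSwinnertonDyer.Theorems.CongruentShaFreeCutKatoKummerLogTorsion

set_option linter.dupNamespace false

namespace Summit.BirchSwinnertonDyer.BirchSwinnertonDyer.Theorems.ErratumRoadFiveKatoFframeALineIndex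

variable (W : WeierstrassCurve ℚ) [W.IsElliptic] [W.IsGloballyMinimal] (p : ℕ) [hp : Fact p.Prime]
  [ContinuousSMul ℤ_[p] (W.tateModule p)]

/-- **THE `A`-LINE INDEX (L3′).**  Rows: `W/ℚ` globally minimal, `rank_ℤ W(ℚ) = 1` generated by `P` modulo torsion, `Ш[p^∞]`
finite, `p ∤ #W(ℚ)_tors`; `x = κ_∞(P)` (`ofTop(red_{p^j} x) = κ_{p^j}(P)`), `integralH1 (tateRep W p) p ⊤ = ℤ_p ∙ (p^a • x)`.
For any `ℤ_p`-extension datum `κ` and any bottom-layer integral class `y` with Kummer logarithm `t ≠ 0`: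
**`a + v(log_ω P) ≤ v(t)`** and **`#(integralH1 (tateRep W p) p (κ.layerSubgroup 0) / ℤ_p ∙ y) = p^{v(t) − a − v(log_ω P)}`.**
[cite: Kato2004Asterisque, Thm. 14.5 and the definition of `[M : z]` (pp. 236–237), §14.18 (p. 244)] [cite: BlochKato1990, Ex. 3.11] -/
theorem le_valuation_and_natCard_quotient_span_eq_pow (κ : ZpExtension ℚ p) (hrank : W.mordellWeilRank = 1)
    (hsha : Finite (AddCommGroup.primaryComponent W.sha p)) (htors : ¬ p ∣ W.torsionOrder) {P : W.toAffine.Point}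
    (hgen : ∀ R : W.toAffine.Point, ∃ n : ℤ, IsOfFinAddOrder (R - n • P)) {x : H1 (tateRep W p) ⊤}
    (hx : ∀ j : ℕ,
      (ofTopSubgroup (W.torsionGaloisModule ((p : ℤ) ^ j)).toTopRep 1).hom (reduceH1Pk W p j ⊤ x) =
        kummerMapTorsion W ((p : ℤ) ^ j) (zsmul_pow_surjective W p j) P)
    {a : ℕ} (ha : integralH1 (tateRep W p) p ⊤ = ℤ_[p] ∙ (p ^ a • x))
    (y : integralH1 (tateRep W p) p (κ.layerSubgroup 0)) {t : ℚ_[p]}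
    (hyt : HasLocPKummerLog W p (layerZeroToTop W p κ (y : H1 (tateRep W p) (κ.layerSubgroup 0))) t) (ht : t ≠ 0) :
    (a : ℤ) + (padicLogLocal W p (Affine.Point.map (W' := W.toAffine) (S := ℚ) (Algebra.ofId ℚ ℚ_[p]) P)).valuation ≤
        t.valuation ∧
      Nat.card (integralH1 (tateRep W p) p (κ.layerSubgroup 0) ⧸ (ℤ_[p] ∙ y)) =
        p ^ (t.valuation - ((a : ℤ) +
          (padicLogLocal W p (Affine.Point.map (W' := W.toAffine) (S := ℚ) (Algebra.ofId ℚ ℚ_[p]) P)).valuation)).toNat := by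
  have hP : ¬ IsOfFinAddOrder P := ContraCount.not_isOfFinAddOrder_of_generates hrank hgen
  -- a Kummer-log functional `φ` on `A₀`; `φ y = t`
  obtain ⟨φ, hφ⟩ := exists_kummerLog_linearMap W p κ hP
  have hφy : φ y = t := (ContraCount.HasLocPKummerLog.unique W p hyt (hφ y)).symm
  have hφy0 : φ y ≠ 0 := by rw [hφy]; exact ht
  -- `φ(A₀) = p^{v₀} ℤ_p` with `v₀ = a + v(log_ω P)`
  haveI := module_finite_integralH1_layerZero W p κ
  obtain ⟨v₀, hv₀⟩ := exists_range_eq_span_zpow φ hφy0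
  obtain ⟨a', ha', hv₀a⟩ :=
    exists_integralH1_eq_span_pow_smul_and_eq_add_valuation W p κ hrank hsha htors hgen hx φ hφ hv₀
  obtain rfl : a = a' := eq_of_integralH1_eq_span_pow_smul W p hP hx ha ha'
  -- the index formula with `#ker φ = 1`
  have hcard := natCard_quotient_span_singleton_eq φ hφy0 hv₀
  rw [kummerLog_injective_of_not_dvd_torsionOrder W p κ hrank hsha htors φ hφ, one_mul, hφy] at hcard
  have hle := le_valuation_of_range_eq φ hv₀ hφy0
  rw [hφy] at hle
  rw [hv₀a] at hle hcard
  exact ⟨hle, hcard⟩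

/-- **L3′ in the currency of the Herbrand helper** (`ErratumRoadFiveKatoFframeH2CoinvariantsIndex`): for a pinned
`I : IwasawaH1Data W p κ γ` and `s ∈ 𝐇¹_Γ` whose bottom class `proj₀ s` has Kummer logarithm `t ≠ 0`,
**`#(A₀ / ℤ_p ∙ proj₀ s) = p^{v(t) − a − v(log_ω P)}`** and `a + v(log_ω P) ≤ v(t)`.  With that helper's
`#(𝐇²_Γ)_Γ ∣ #(A₀ / ℤ_p ∙ proj₀ s)` this reads `#(𝐇²_Γ)_Γ ∣ p^{v(t) − a − v(log_ω P)}` (S1Λ level-0 chain, steps (1)+(3)).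
[cite: Kato2004Asterisque, §14.14 (14.14.1) (p. 243), Thm. 14.5 (pp. 236–237), §14.18 (p. 244)] -/
theorem le_valuation_and_natCard_quotient_span_proj_eq_pow (κ : ZpExtension ℚ p) (γ : absoluteGaloisGroup ℚ)
    (hrank : W.mordellWeilRank = 1) (hsha : Finite (AddCommGroup.primaryComponent W.sha p)) (htors : ¬ p ∣ W.torsionOrder)
    {P : W.toAffine.Point} (hgen : ∀ R : W.toAffine.Point, ∃ n : ℤ, IsOfFinAddOrder (R - n • P)) {x : H1 (tateRep W p) ⊤}
    (hx : ∀ j : ℕ,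
      (ofTopSubgroup (W.torsionGaloisModule ((p : ℤ) ^ j)).toTopRep 1).hom (reduceH1Pk W p j ⊤ x) =
        kummerMapTorsion W ((p : ℤ) ^ j) (zsmul_pow_surjective W p j) P)
    {a : ℕ} (ha : integralH1 (tateRep W p) p ⊤ = ℤ_[p] ∙ (p ^ a • x))
    (I : IwasawaH1Data W p κ γ) (s : I.H) {t : ℚ_[p]}
    (hst : HasLocPKummerLog W p (layerZeroToTop W p κ (I.proj 0 s)) t) (ht : t ≠ 0) :
    (a : ℤ) + (padicLogLocal W p (Affine.Point.map (W' := W.toAffine) (S := ℚ) (Algebra.ofId ℚ ℚ_[p]) P)).valuation ≤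
        t.valuation ∧
      Nat.card (integralH1 (tateRep W p) p (κ.layerSubgroup 0) ⧸
          Submodule.span ℤ_[p] {(⟨I.proj 0 s, I.proj_mem 0 s⟩ : integralH1 (tateRep W p) p (κ.layerSubgroup 0))}) =
        p ^ (t.valuation - ((a : ℤ) +
          (padicLogLocal W p (Affine.Point.map (W' := W.toAffine) (S := ℚ) (Algebra.ofId ℚ ℚ_[p]) P)).valuation)).toNat :=
  le_valuation_and_natCard_quotient_span_eq_pow W p κ hrank hsha htors hgen hx ha ⟨I.proj 0 s, I.proj_mem 0 s⟩ hst ht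

/-- **L3′ in EXACTLY the `hindex` currency of the LEAD's assembly** (`ErratumRoadFiveKatoFframeLambdaAssembly.katoLambdaLogBound_of_counts`
/ `extremal_bound_of_counts`, binder `hindex`): **`ord_p #(A₀ / ℤ_p ∙ proj₀ s) = v(t) − v(log_ω P) − a`** (equality; the
assembly consumes `≤`). [cite: Kato2004Asterisque, §14.14 (14.14.1) (p. 243), Thm. 14.5 (pp. 236–237), §14.18 (p. 244)] -/
theorem padicValNat_card_quotient_span_proj_eq (κ : ZpExtension ℚ p) (γ : absoluteGaloisGroup ℚ)
    (hrank : W.mordellWeilRank = 1) (hsha : Finite (AddCommGroup.primaryComponent W.sha p)) (htors : ¬ p ∣ W.torsionOrder)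
    {P : W.toAffine.Point} (hgen : ∀ R : W.toAffine.Point, ∃ n : ℤ, IsOfFinAddOrder (R - n • P)) {x : H1 (tateRep W p) ⊤}
    (hx : ∀ j : ℕ,
      (ofTopSubgroup (W.torsionGaloisModule ((p : ℤ) ^ j)).toTopRep 1).hom (reduceH1Pk W p j ⊤ x) =
        kummerMapTorsion W ((p : ℤ) ^ j) (zsmul_pow_surjective W p j) P)
    {a : ℕ} (ha : integralH1 (tateRep W p) p ⊤ = ℤ_[p] ∙ (p ^ a • x))
    (I : IwasawaH1Data W p κ γ) (s : I.H) {t : ℚ_[p]}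
    (hst : HasLocPKummerLog W p (layerZeroToTop W p κ (I.proj 0 s)) t) (ht : t ≠ 0) :
    (padicValNat p (Nat.card (integralH1 (tateRep W p) p (κ.layerSubgroup 0) ⧸
        Submodule.span ℤ_[p] {(⟨I.proj 0 s, I.proj_mem 0 s⟩ : integralH1 (tateRep W p) p (κ.layerSubgroup 0))})) : ℤ) =
      t.valuation - (padicLogLocal W p (WeierstrassCurve.Affine.Point.map (Algebra.ofId ℚ ℚ_[p]) P)).valuation - a := by
  obtain ⟨hle, hcard⟩ :=
    le_valuation_and_natCard_quotient_span_proj_eq_pow W p κ γ hrank hsha htors hgen hx ha I s hst ht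
  rw [hcard, padicValNat.prime_pow, Int.toNat_of_nonneg (by linarith)]
  ring

/-- **The assembly's `hindex` VERBATIM: `ord_p #(A₀ / ℤ_p ∙ proj₀ s) ≤ v(t) − v(log_ω P) − a`.**
[cite: Kato2004Asterisque, §14.14 (14.14.1) (p. 243), Thm. 14.5 (pp. 236–237), §14.18 (p. 244)] -/
theorem padicValNat_card_quotient_span_proj_le (κ : ZpExtension ℚ p) (γ : absoluteGaloisGroup ℚ)
    (hrank : W.mordellWeilRank = 1) (hsha : Finite (AddCommGroup.primaryComponent W.sha p)) (htors : ¬ p ∣ W.torsionOrder)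
    {P : W.toAffine.Point} (hgen : ∀ R : W.toAffine.Point, ∃ n : ℤ, IsOfFinAddOrder (R - n • P)) {x : H1 (tateRep W p) ⊤}
    (hx : ∀ j : ℕ,
      (ofTopSubgroup (W.torsionGaloisModule ((p : ℤ) ^ j)).toTopRep 1).hom (reduceH1Pk W p j ⊤ x) =
        kummerMapTorsion W ((p : ℤ) ^ j) (zsmul_pow_surjective W p j) P)
    {a : ℕ} (ha : integralH1 (tateRep W p) p ⊤ = ℤ_[p] ∙ (p ^ a • x))
    (I : IwasawaH1Data W p κ γ) (s : I.H) {t : ℚ_[p]}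
    (hst : HasLocPKummerLog W p (layerZeroToTop W p κ (I.proj 0 s)) t) (ht : t ≠ 0) :
    (padicValNat p (Nat.card (integralH1 (tateRep W p) p (κ.layerSubgroup 0) ⧸
        Submodule.span ℤ_[p] {(⟨I.proj 0 s, I.proj_mem 0 s⟩ : integralH1 (tateRep W p) p (κ.layerSubgroup 0))})) : ℤ) ≤
      t.valuation - (padicLogLocal W p (WeierstrassCurve.Affine.Point.map (Algebra.ofId ℚ ℚ_[p]) P)).valuation - a :=
  (padicValNat_card_quotient_span_proj_eq W p κ γ hrank hsha htors hgen hx ha I s hst ht).le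

end Summit.BirchSwinnertonDyer.BirchSwinnertonDyer.Theorems.ErratumRoadFiveKatoFframeALineIndex

end
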